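import Summits.NavierStokesRegularity.NavierStokesRegularity.Theorems.SoloRefuteSiche2026SeriesCore
import HarnessLib

/-!
# C135 `Siche2026` — face (A) series block, part 2/2: the lacunary sine / cosine shear SOLUTIONS

(imports part 1, `SoloRefuteSiche2026SeriesCore`). typist-11 g4's interface (INBOX 05:45:33Z):

* SINE: `lacScalar k = −(i/2)·sgn(k₀)·e^{−|k|}` on `{±5^j e₀}`, `0` elsewhere — `lacProfile (x) = Σ_j b_j sin(2π 5^j x₀)`,
  `b_j = e^{−5^j}`. SIGN CONVENTION: `sin(2πN s) = (e^{2πiNs} − e^{−2πiNs})/(2i)`, so the coefficient of `e_{+N e₀}` is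
  `−i b/2` and of `e_{−N e₀}` is `+i b/2` (`lacCoeff_axis_pos/neg`, `lacCoeff k = lacScalar k • e₁`, ŷ-polarised);
  `lacU ν T t x = lacTheta ν T t x • e₁` with `lacTheta` the heat flow of `lacProfile` on `[0, T]`;
  `isClassicalNSSolutionOn_lacU : IsClassicalNSSolutionOn (Ico 0 T) ν 0 (lacU ν T) (fun _ _ => 0)` (`0 < ν`, `0 < T`);
  `coeff_lacU : 𝓕(complexify ∘ lacU ν T t)(k) = e^{−4π²ν|k|²t} • lacCoeff k` for `t ∈ Icc 0 T`; `lacU_zero`.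
* COSINE: `lacScalarCos k = e^{−|k|}/2` on the same support (`Σ_j b_j cos(2π 5^j x₀)`), `lacUcos`,
  `isClassicalNSSolutionOn_lacUcos`, `coeff_lacUcos`, `lacUcos_zero`.

In the typed gauge (39) the support modes `±5^j e₀` have `ê₁ = ±ŷ`, so these ŷ-polarised coefficients are seen by
the typed `χ` (refuter-7 g2 TYPED READ 05:28:22Z (1); ref-3 g3 05:28:25Z); the `χ`-evaluation itself is NOT done here.
-/

noncomputable section

-- cell convention (SoloRefute files): the Theorems namespace repeats `NavierStokesRegularity`.
set_option linter.dupNamespace false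

open MeasureTheory Finset UnitAddTorus Set
open Literature.Analysis Literature.Analysis.FluidPDE Literature.Analysis.FunctionSpaces
open Literature.Analysis.FunctionSpaces.Torus

namespace Summit.NavierStokesRegularity.NavierStokesRegularity.Theorems.Siche2026.Series

/-! ## 3. The sine instance (typist-11 g4's interface) -/

/-- The sign of `k₀` as a complex number (`+1` for `k₀ > 0`, `−1` otherwise). [folklore] -/
def sgn0 (k : Z3) : ℂ := if 0 < k 0 then 1 else -1

/-- The SCALAR Fourier coefficients of the sine profile: `−(i/2)·sgn(k₀)·e^{−|k|}` on the support, `0` off it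
(`Σ_j e^{−5^j} sin(2π 5^j x₀)`; `sin(2πNs) = (e^{2πiNs} − e^{−2πiNs})/(2i)`). [folklore] -/
def lacScalar : Z3 → ℂ :=
  lacSupp.indicator fun k => -(Complex.I / 2) * sgn0 k * (amp k : ℂ)

/-- Off the support the scalar coefficient vanishes. [folklore] -/
theorem lacScalar_of_not_mem {k : Z3} (hk : k ∉ lacSupp) : lacScalar k = 0 :=
  Set.indicator_of_notMem hk _

/-- On the support the scalar coefficient is `−(i/2)·sgn(k₀)·e^{−|k|}`. [folklore] -/
theorem lacScalar_of_mem {k : Z3} (hk : k ∈ lacSupp) :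
    lacScalar k = -(Complex.I / 2) * sgn0 k * (amp k : ℂ) :=
  Set.indicator_of_mem hk _

/-- `lacScalar (5^j e₀) = −(i/2) e^{−5^j}`. [folklore] -/
theorem lacScalar_ax0_pow (j : ℕ) :
    lacScalar (ax0 (5 ^ j)) = -(Complex.I / 2) * (Real.exp (-(5 : ℝ) ^ j) : ℂ) := by
  rw [lacScalar_of_mem (ax0_pow_mem j), sgn0, if_pos (by simp), mul_one, amp_ax0_pow]

/-- `lacScalar (−5^j e₀) = +(i/2) e^{−5^j}`. [folklore] -/
theorem lacScalar_ax0_neg_pow (j : ℕ) :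
    lacScalar (ax0 (-(5 ^ j))) = (Complex.I / 2) * (Real.exp (-(5 : ℝ) ^ j) : ℂ) := by
  have hneg : ¬ (0 < ax0 (-(5 ^ j)) 0) := by
    rw [ax0_apply_zero, not_lt, neg_nonpos]; positivity
  rw [lacScalar_of_mem (ax0_neg_pow_mem j), sgn0, if_neg hneg, amp_ax0_neg_pow]
  ring

/-- `‖lacScalar k‖ ≤ e^{−|k|}`. [folklore] -/
theorem norm_lacScalar_le (k : Z3) : ‖lacScalar k‖ ≤ amp k := by
  by_cases hk : k ∈ lacSupp
  · rw [lacScalar_of_mem hk, norm_mul, norm_mul, Complex.norm_real, Real.norm_of_nonneg (amp_pos k).le]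
    have h1 : ‖-(Complex.I / 2)‖ = 1 / 2 := by simp
    have h2 : ‖sgn0 k‖ = 1 := by unfold sgn0; split_ifs <;> simp
    rw [h1, h2]
    linarith [amp_pos k]
  · rw [lacScalar_of_not_mem hk, norm_zero]; exact (amp_pos k).le

/-- Rapid decay of the sine coefficients. [folklore] -/
theorem rapidDecay_lacScalar : RapidDecay lacScalar :=
  rapidDecay_of_norm_le_amp norm_lacScalar_le

/-- Conjugate symmetry of the sine coefficients (reality of the profile). [folklore] -/
theorem conj_lacScalar (k : Z3) : starRingEnd ℂ (lacScalar k) = lacScalar (-k) := by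
  by_cases hk : k ∈ lacSupp
  · have hk' := neg_mem_lacSupp hk
    have h0 := apply_zero_ne_zero_of_mem hk
    rw [lacScalar_of_mem hk, lacScalar_of_mem hk', amp_neg]
    simp only [map_mul, map_neg, map_div₀, Complex.conj_I, Complex.conj_ofReal, map_ofNat, sgn0,
      Pi.neg_apply, Left.neg_pos_iff]
    have hs : starRingEnd ℂ (if 0 < k 0 then (1 : ℂ) else -1) = if 0 < k 0 then 1 else -1 := by
      split_ifs <;> simp
    rw [hs]
    rcases lt_or_gt_of_ne h0 with h | h
    · rw [if_neg (not_lt.mpr h.le), if_pos h]; ring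
    · rw [if_pos h, if_neg (not_lt.mpr h.le)]; ring
  · have hk' : -k ∉ lacSupp := fun h => hk (by simpa using neg_mem_lacSupp h)
    rw [lacScalar_of_not_mem hk, lacScalar_of_not_mem hk', map_zero]

/-- The sine coefficients live on the `e₀`-axis. [folklore] -/
theorem lacScalar_off_axis (k : Z3) (hk : k 1 ≠ 0 ∨ k 2 ≠ 0) : lacScalar k = 0 :=
  lacScalar_of_not_mem (not_mem_lacSupp_of_off_axis hk)

/-- **The lacunary sine profile** `Σ_j e^{−5^j} sin(2π 5^j x₀)`. [folklore] -/
def lacProfile : T3 → ℝ := profile lacScalar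

/-- The sine profile is smooth. [folklore] -/
theorem isSmooth_lacProfile : IsSmooth lacProfile := isSmooth_profile rapidDecay_lacScalar

/-- The sine profile depends on `x₀` only (`i = 1, 2`). [folklore] -/
theorem lacProfile_add_single {i : Fin 3} (hi : i ≠ 0) (s : UnitAddCircle) (x : T3) :
    lacProfile (x + Pi.single i s) = lacProfile x :=
  profile_add_single lacScalar_off_axis hi s x

/-- The Fourier coefficients of the sine profile. [folklore] -/
theorem mFourierCoeff_lacProfile (k : Z3) : mFourierCoeff (fun y => (lacProfile y : ℂ)) k = lacScalar k :=
  mFourierCoeff_profile rapidDecay_lacScalar conj_lacScalar k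

/-- **The vector Fourier coefficients of the sine datum**: `lacScalar k • e₁` (ŷ-polarised). [folklore] -/
def lacCoeff (k : Z3) : C3 := lacScalar k • e1C

/-- `lacCoeff (5^j e₀) = (0, −(i/2) e^{−5^j}, 0)`. [folklore] -/
theorem lacCoeff_axis_pos (j : ℕ) :
    lacCoeff (ax0 (5 ^ j)) = (-(Complex.I / 2) * (Real.exp (-(5 : ℝ) ^ j) : ℂ)) • e1C := by
  rw [lacCoeff, lacScalar_ax0_pow]

/-- `lacCoeff (−5^j e₀) = (0, +(i/2) e^{−5^j}, 0)`. [folklore] -/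
theorem lacCoeff_axis_neg (j : ℕ) :
    lacCoeff (ax0 (-(5 ^ j))) = ((Complex.I / 2) * (Real.exp (-(5 : ℝ) ^ j) : ℂ)) • e1C := by
  rw [lacCoeff, lacScalar_ax0_neg_pow]

/-- Off the support the vector coefficient vanishes. [folklore] -/
theorem lacCoeff_off {k : Z3} (hk : k ∉ lacSupp) : lacCoeff k = 0 := by
  rw [lacCoeff, lacScalar_of_not_mem hk, zero_smul]

/-- Components: `(lacCoeff k)ᵢ = lacScalar k · [i = 1]`. [folklore] -/
theorem lacCoeff_apply (k : Z3) (i : Fin 3) :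
    lacCoeff k i = lacScalar k * (if i = 1 then 1 else 0) := by
  simp [lacCoeff, e1C]

/-- The heat flow of the sine profile on `[0, T]`: a chosen jointly smooth solution of `∂ₜθ = νΔθ`,
`θ(0) = lacProfile`, invariant along `e₁` (`Torus.exists_parallel_heat`); junk `0` unless `0 < ν`, `0 < T`.
[folklore] -/
def lacTheta (ν T : ℝ) : ℝ → T3 → ℝ :=
  if h : 0 < ν ∧ 0 < T then
    (Torus.exists_parallel_heat h.1 h.2 (1 : Fin 3) isSmooth_lacProfile
      (lacProfile_add_single (i := 1) (by decide))).choose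
  else fun _ _ => 0

/-- The specification of `lacTheta`. [folklore] -/
theorem lacTheta_spec {ν T : ℝ} (hν : 0 < ν) (hT : 0 < T) :
    IsSmoothSpaceTimeOn (Icc 0 T) (lacTheta ν T) ∧ lacTheta ν T 0 = lacProfile ∧
      (∀ t ∈ Icc 0 T, ∀ (s : UnitAddCircle) (x : T3),
        lacTheta ν T t (x + Pi.single (1 : Fin 3) s) = lacTheta ν T t x) ∧
      (∀ t ∈ Icc 0 T, ∀ x, Torus.timeDerivWithin (Icc 0 T) (lacTheta ν T) t x = ν * Torus.laplacian (lacTheta ν T t) x) := by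
  have h : 0 < ν ∧ 0 < T := ⟨hν, hT⟩
  rw [lacTheta, dif_pos h]
  exact (Torus.exists_parallel_heat h.1 h.2 (1 : Fin 3) isSmooth_lacProfile
    (lacProfile_add_single (i := 1) (by decide))).choose_spec

/-- **The lacunary sine shear solution** `lacU ν T t x = θ(t, x) e₁` (ŷ-polarised). [folklore] -/
def lacU (ν T : ℝ) (t : ℝ) (x : T3) : E3 := lacTheta ν T t x • EuclideanSpace.single 1 1

/-- `lacU ν T = fun t x => lacTheta ν T t x • e₁`. [folklore] -/
theorem lacU_eq (ν T : ℝ) : lacU ν T = fun t x => lacTheta ν T t x • (EuclideanSpace.single 1 1 : E3) := rfl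

/-- The datum: `lacU ν T 0 x = lacProfile x • e₁`. [folklore] -/
theorem lacU_zero {ν T : ℝ} (hν : 0 < ν) (hT : 0 < T) (x : T3) :
    lacU ν T 0 x = lacProfile x • EuclideanSpace.single 1 1 := by
  have h := congrFun (lacTheta_spec hν hT).2.1 x
  rw [lacU, h]

/-- **`lacU` is a classical Navier–Stokes solution on `Icc 0 T`** (zero force, zero pressure). [folklore] -/
theorem isClassicalNSSolutionOn_lacU_Icc {ν T : ℝ} (hν : 0 < ν) (hT : 0 < T) :
    IsClassicalNSSolutionOn (Icc 0 T) ν 0 (lacU ν T) (fun _ _ => 0) := by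
  obtain ⟨hθ, -, hinv, hheat⟩ := lacTheta_spec hν hT
  rw [lacU_eq]
  exact isClassicalNSSolutionOn_shear_Icc hT hθ hinv hheat

/-- **`lacU` is a classical Navier–Stokes solution on `Ico 0 T`** (the time set of the C135 skeleton). [folklore] -/
theorem isClassicalNSSolutionOn_lacU {ν T : ℝ} (hν : 0 < ν) (hT : 0 < T) :
    IsClassicalNSSolutionOn (Ico 0 T) ν 0 (lacU ν T) (fun _ _ => 0) :=
  (isClassicalNSSolutionOn_lacU_Icc hν hT).mono Ico_subset_Icc_self (uniqueDiffOn_Ico 0 T)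

/-- **The Fourier coefficients along the sine flow**: `𝓕(lacU ν T t)(k) = e^{−4π²ν|k|²t} • lacCoeff k` for
`t ∈ [0, T]`. [folklore] -/
theorem coeff_lacU {ν T : ℝ} (hν : 0 < ν) (hT : 0 < T) {t : ℝ} (ht : t ∈ Icc 0 T) (k : Z3) :
    mFourierCoeff (EuclideanSpace.complexify ∘ lacU ν T t) k =
      ((Real.exp (-(4 * Real.pi ^ 2 * ν * freqNormSq k) * t) : ℝ) : ℂ) • lacCoeff k := by
  obtain ⟨hθ, h0, -, hheat⟩ := lacTheta_spec hν hT
  exact coeff_shear hT rapidDecay_lacScalar conj_lacScalar hθ h0 hheat ht k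

/-- Componentwise: `𝓕(lacU ν T t)(k)ᵢ = e^{−4π²ν|k|²t} · lacScalar k · [i = 1]`. [folklore] -/
theorem coeff_lacU_apply {ν T : ℝ} (hν : 0 < ν) (hT : 0 < T) {t : ℝ} (ht : t ∈ Icc 0 T) (k : Z3)
    (i : Fin 3) :
    mFourierCoeff (EuclideanSpace.complexify ∘ lacU ν T t) k i =
      ((Real.exp (-(4 * Real.pi ^ 2 * ν * freqNormSq k) * t) : ℝ) : ℂ) * (lacScalar k * (if i = 1 then 1 else 0)) := by
  rw [coeff_lacU hν hT ht k, PiLp.smul_apply, smul_eq_mul, lacCoeff_apply]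

/-- Off the support every Fourier coefficient of the sine flow vanishes (silent shells). [folklore] -/
theorem coeff_lacU_off {ν T : ℝ} (hν : 0 < ν) (hT : 0 < T) {t : ℝ} (ht : t ∈ Icc 0 T) {k : Z3}
    (hk : k ∉ lacSupp) : mFourierCoeff (EuclideanSpace.complexify ∘ lacU ν T t) k = 0 := by
  rw [coeff_lacU hν hT ht k, lacCoeff_off hk, smul_zero]

/-! ## 4. The cosine instance -/

/-- The SCALAR Fourier coefficients of the cosine profile: `(1/2)·e^{−|k|}` on the support, `0` off it
(`Σ_j e^{−5^j} cos(2π 5^j x₀)`; `cos(2πNs) = (e^{2πiNs} + e^{−2πiNs})/2`). [folklore] -/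
def lacScalarCos : Z3 → ℂ :=
  lacSupp.indicator fun k => ((amp k / 2 : ℝ) : ℂ)

/-- Off the support the cosine coefficient vanishes. [folklore] -/
theorem lacScalarCos_of_not_mem {k : Z3} (hk : k ∉ lacSupp) : lacScalarCos k = 0 :=
  Set.indicator_of_notMem hk _

/-- On the support the cosine coefficient is `e^{−|k|}/2`. [folklore] -/
theorem lacScalarCos_of_mem {k : Z3} (hk : k ∈ lacSupp) : lacScalarCos k = ((amp k / 2 : ℝ) : ℂ) :=
  Set.indicator_of_mem hk _

/-- `lacScalarCos (±5^j e₀) = e^{−5^j}/2`. [folklore] -/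
theorem lacScalarCos_ax0_pow (j : ℕ) :
    lacScalarCos (ax0 (5 ^ j)) = ((Real.exp (-(5 : ℝ) ^ j) / 2 : ℝ) : ℂ) ∧
      lacScalarCos (ax0 (-(5 ^ j))) = ((Real.exp (-(5 : ℝ) ^ j) / 2 : ℝ) : ℂ) := by
  rw [lacScalarCos_of_mem (ax0_pow_mem j), lacScalarCos_of_mem (ax0_neg_pow_mem j), amp_ax0_pow,
    amp_ax0_neg_pow]
  exact ⟨rfl, rfl⟩

/-- `‖lacScalarCos k‖ ≤ e^{−|k|}`. [folklore] -/
theorem norm_lacScalarCos_le (k : Z3) : ‖lacScalarCos k‖ ≤ amp k := by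
  by_cases hk : k ∈ lacSupp
  · rw [lacScalarCos_of_mem hk, Complex.norm_real, Real.norm_of_nonneg (by linarith [amp_pos k])]
    linarith [amp_pos k]
  · rw [lacScalarCos_of_not_mem hk, norm_zero]; exact (amp_pos k).le

/-- Rapid decay of the cosine coefficients. [folklore] -/
theorem rapidDecay_lacScalarCos : RapidDecay lacScalarCos :=
  rapidDecay_of_norm_le_amp norm_lacScalarCos_le

/-- Conjugate symmetry of the cosine coefficients (real and even). [folklore] -/
theorem conj_lacScalarCos (k : Z3) : starRingEnd ℂ (lacScalarCos k) = lacScalarCos (-k) := by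
  by_cases hk : k ∈ lacSupp
  · rw [lacScalarCos_of_mem hk, lacScalarCos_of_mem (neg_mem_lacSupp hk), amp_neg, Complex.conj_ofReal]
  · have hk' : -k ∉ lacSupp := fun h => hk (by simpa using neg_mem_lacSupp h)
    rw [lacScalarCos_of_not_mem hk, lacScalarCos_of_not_mem hk', map_zero]

/-- The cosine coefficients live on the `e₀`-axis. [folklore] -/
theorem lacScalarCos_off_axis (k : Z3) (hk : k 1 ≠ 0 ∨ k 2 ≠ 0) : lacScalarCos k = 0 :=
  lacScalarCos_of_not_mem (not_mem_lacSupp_of_off_axis hk)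

/-- **The lacunary cosine profile** `Σ_j e^{−5^j} cos(2π 5^j x₀)`. [folklore] -/
def lacProfileCos : T3 → ℝ := profile lacScalarCos

/-- The cosine profile is smooth. [folklore] -/
theorem isSmooth_lacProfileCos : IsSmooth lacProfileCos := isSmooth_profile rapidDecay_lacScalarCos

/-- The cosine profile depends on `x₀` only (`i = 1, 2`). [folklore] -/
theorem lacProfileCos_add_single {i : Fin 3} (hi : i ≠ 0) (s : UnitAddCircle) (x : T3) :
    lacProfileCos (x + Pi.single i s) = lacProfileCos x :=
  profile_add_single lacScalarCos_off_axis hi s x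

/-- The vector coefficients of the cosine datum. [folklore] -/
def lacCoeffCos (k : Z3) : C3 := lacScalarCos k • e1C

/-- Off the support the cosine vector coefficient vanishes. [folklore] -/
theorem lacCoeffCos_off {k : Z3} (hk : k ∉ lacSupp) : lacCoeffCos k = 0 := by
  rw [lacCoeffCos, lacScalarCos_of_not_mem hk, zero_smul]

/-- The heat flow of the cosine profile on `[0, T]` (as `lacTheta`). [folklore] -/
def lacThetaCos (ν T : ℝ) : ℝ → T3 → ℝ :=
  if h : 0 < ν ∧ 0 < T then
    (Torus.exists_parallel_heat h.1 h.2 (1 : Fin 3) isSmooth_lacProfileCos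
      (lacProfileCos_add_single (i := 1) (by decide))).choose
  else fun _ _ => 0

/-- The specification of `lacThetaCos`. [folklore] -/
theorem lacThetaCos_spec {ν T : ℝ} (hν : 0 < ν) (hT : 0 < T) :
    IsSmoothSpaceTimeOn (Icc 0 T) (lacThetaCos ν T) ∧ lacThetaCos ν T 0 = lacProfileCos ∧
      (∀ t ∈ Icc 0 T, ∀ (s : UnitAddCircle) (x : T3),
        lacThetaCos ν T t (x + Pi.single (1 : Fin 3) s) = lacThetaCos ν T t x) ∧
      (∀ t ∈ Icc 0 T, ∀ x,
        Torus.timeDerivWithin (Icc 0 T) (lacThetaCos ν T) t x = ν * Torus.laplacian (lacThetaCos ν T t) x) := by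
  have h : 0 < ν ∧ 0 < T := ⟨hν, hT⟩
  rw [lacThetaCos, dif_pos h]
  exact (Torus.exists_parallel_heat h.1 h.2 (1 : Fin 3) isSmooth_lacProfileCos
    (lacProfileCos_add_single (i := 1) (by decide))).choose_spec

/-- **The lacunary cosine shear solution** `lacUcos ν T t x = θcos(t, x) e₁`. [folklore] -/
def lacUcos (ν T : ℝ) (t : ℝ) (x : T3) : E3 := lacThetaCos ν T t x • EuclideanSpace.single 1 1

/-- `lacUcos ν T = fun t x => lacThetaCos ν T t x • e₁`. [folklore] -/
theorem lacUcos_eq (ν T : ℝ) :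
    lacUcos ν T = fun t x => lacThetaCos ν T t x • (EuclideanSpace.single 1 1 : E3) := rfl

/-- The datum of the cosine flow. [folklore] -/
theorem lacUcos_zero {ν T : ℝ} (hν : 0 < ν) (hT : 0 < T) (x : T3) :
    lacUcos ν T 0 x = lacProfileCos x • EuclideanSpace.single 1 1 := by
  have h := congrFun (lacThetaCos_spec hν hT).2.1 x
  rw [lacUcos, h]

/-- **`lacUcos` is a classical Navier–Stokes solution on `Ico 0 T`.** [folklore] -/
theorem isClassicalNSSolutionOn_lacUcos {ν T : ℝ} (hν : 0 < ν) (hT : 0 < T) :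
    IsClassicalNSSolutionOn (Ico 0 T) ν 0 (lacUcos ν T) (fun _ _ => 0) := by
  obtain ⟨hθ, -, hinv, hheat⟩ := lacThetaCos_spec hν hT
  rw [lacUcos_eq]
  exact (isClassicalNSSolutionOn_shear_Icc hT hθ hinv hheat).mono Ico_subset_Icc_self (uniqueDiffOn_Ico 0 T)

/-- **The Fourier coefficients along the cosine flow.** [folklore] -/
theorem coeff_lacUcos {ν T : ℝ} (hν : 0 < ν) (hT : 0 < T) {t : ℝ} (ht : t ∈ Icc 0 T) (k : Z3) :
    mFourierCoeff (EuclideanSpace.complexify ∘ lacUcos ν T t) k =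
      ((Real.exp (-(4 * Real.pi ^ 2 * ν * freqNormSq k) * t) : ℝ) : ℂ) • lacCoeffCos k := by
  obtain ⟨hθ, h0, -, hheat⟩ := lacThetaCos_spec hν hT
  exact coeff_shear hT rapidDecay_lacScalarCos conj_lacScalarCos hθ h0 hheat ht k

end Summit.NavierStokesRegularity.NavierStokesRegularity.Theorems.Siche2026.Series

end
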